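import Summits.FinalStateConjecture.FinalStateConjecture.Theorems.SwallowTheDatumUniversalWitnessFamilySheetLineReduction
import Summits.FinalStateConjecture.FinalStateConjecture.Theorems.SwallowTheDatumUniversalWitnessFamilyStubSocketBagOfPlugDataPlusFrom
import Summits.FinalStateConjecture.FinalStateConjecture.Theorems.SwallowTheDatumUniversalWitnessFamilyStubModelData
import Summits.FinalStateConjecture.FinalStateConjecture.Theorems.SwallowTheDatumUniversalWitnessFamilyStubSchwOutSite
import Summits.FinalStateConjecture.FinalStateConjecture.Theorems.SwallowTheDatumUniversalWitnessFamilyStubPlugDataPlusFromOf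
import Summits.FinalStateConjecture.FinalStateConjecture.Theorems.SwallowTheDatumUniversalWitnessFamilyStubCapEnd
import Summits.FinalStateConjecture.FinalStateConjecture.Theorems.SwallowTheDatumUniversalWitnessFamilyStubPlugDataPlusSharpOf
import Summits.FinalStateConjecture.FinalStateConjecture.Theorems.SwallowTheDatumUniversalWitnessFamilyStubUniversalSocketBagOfPlugDataPlusSharp
import HarnessLib

/-!
# Line `Sketch` (= idea `throat-settles-too`) — skeleton v7.3 for the crux
# `SwallowTheDatum.UniversalWitnessFamily` (item stmt-FinalStateConjecture-10051)

Continuation lead `prover-line-stmt-FinalStateConjecture-10051-c2-0`, 2026-08-16, after WAVE 1 (all five stubs LANDED):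
`stub_socketBag_of_plugDataPlusFrom` (p107696), `stub_modelData` (p121083), `stub_schwOutSite` (p121078 + Aux1 p108381,
Aux2 p111027), `stub_plugDataPlusFrom_of` (p116642 + Aux1 p107796, Aux2 p107797, Aux3 p116619/p119518), `stub_capEnd`
(p119170 + Aux1 p107422/p112108, Aux2 p115349) — files `Theorems/SwallowTheDatumUniversalWitnessFamilyStub*.lean`.

STATE OF THE LINE.  The universal socket bag is now PROVED in the tree from the printed, vendored Mao–Oh–Tao Thm 1.7
(`Literature.Geometry.Lorentzian.MaoOhTao.ObstructionFreeAnnularGluing`, by name) and ONE remaining explicit-analysis statement,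
`stub_bulkAt` (the Brill–Lindquist bulk and its `N + 2` sites, repaired quantifier) — `socketBag_of_bulkAt` below.  The far
gluing is, since route rev 9 (crux-strategist, 15:07Z), the ROUTE ITEM `FarAnnulusGluing` (stmt-15427; = the shared
`stub_farGluing` with the line vocabulary inlined, `farGluing_of_item` is `id`); it is taken BY NAME like `MGHDExists` (9937) and
`SubdataDevelopmentsEmbed` (10053).  Hence the skeleton theorem is

  `MGHDExists → SubdataDevelopmentsEmbed → FarAnnulusGluing → Sig.stub_gluingFact (:= ObstructionFreeAnnularGluing) → Sig.stub_bulkAt → UWF`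

with the named-fact debt `stub_gluingFact` declared as a stub (the skeleton checker admits only registered obligations / declared stubs as
hypotheses) and ONE open registered stub of substance: `stub_bulkAt` (XL; = hypothesis 6 of the landed S4 verbatim; also registered on crux 10052, whose
continuation lead c2 HOLDS it and has reshaped it there into `stub_siteMargin` (BK1) + `stub_bulkDatum` (BK2) + the ring/central
puncture assembly — not duplicated here); the two small stubs S4♯ / B♯ (WAVE 2, LANDED p121563 / p121565) make the same landed chain
prove the route's new crux item `UniversalSocketBag` (stmt-15426, deep form): `universalSocketBag_of_bulkAt : MOT → bulkAt → UniversalSocketBag`.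

## Disproof used (`Cruxes/UniversalWitnessFamily/Disproof.lean`, cdisprove cycle 1 FINAL, NO KILL; unchanged since v4; no `-- Targets`)

§3 `uwf_false_without_memAdmissible` / `_without_constraints`: every member admissible (transport-patch conclusion, landed);
`uwfWithoutNeZero_iff`: only `c ≠ 0` members shielded; `uwfWithoutT2_false_of`: `[T2Space X]` kept.  §5: receding witness
(`junction`: `R(c) = R⋆ + 1 + ‖c‖⁻²`).  §6 `settledIn_minkowski`: template of the landed region-I decomposition.
-/

set_option linter.dupNamespace false

noncomputable section

namespace Summit.FinalStateConjecture.FinalStateConjecture.Cruxes.UniversalWitnessFamily.ThroatSettlesToo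

open scoped Manifold ContDiff Topology BigOperators InnerProductSpace
open Set Filter Function MeasureTheory Literature.Geometry.Lorentzian
open Literature.Geometry.Lorentzian.MaoOhTao Literature.Geometry.Lorentzian.InitialDataSet
open Summit.FinalStateConjecture.FinalStateConjecture.Theses.SwallowTheDatum
  (UniversalWitnessFamily MGHDExists SubdataDevelopmentsEmbed FarAnnulusGluing UniversalSocketBag)
open Summit.FinalStateConjecture.FinalStateConjecture.Theorems.SwallowTheDatum.ParametricKerrBurial
  (SmoothSectionsOn AgreeAt IsExactSchwarzschildBeyond IsSchwarzschildAnnulus VacuumOn IsIsotropicBeyond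
    MOTHyp VacAt CapEndAt schwField flatField zeroField FlatVacuumDatum SchwDatum SchwOutSite BulkAt invReadH invReadK)
open Summit.FinalStateConjecture.FinalStateConjecture.Theorems.SwallowTheDatum.UniversalWitnessFamily
  (stub_socketBag_of_plugDataPlusFrom stub_modelData stub_schwOutSite stub_plugDataPlusFrom_of stub_capEnd)
open Summit.FinalStateConjecture.FinalStateConjecture.Theorems.SwallowTheDatum.UniversalWitnessFamily.SheetLine
  (universalWitnessFamily_of_farGluing_of_socketBag)

/-! ## §1 The stub STATEMENTS (`Sig.stub_<name> : Prop`) -/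

/-- **Far gluing in the line's vocabulary** (= crux 10052's registered `stub_farGluing` VERBATIM = route item `FarAnnulusGluing`
(stmt-15427) with `SmoothSectionsOn` / `AgreeAt` / `IsExactSchwarzschildBeyond` folded back).  Through every admissible `d` on `X`:
a sole end `e`, a threshold `R⋆`, a smooth mass function `m R ≥ ηR` and a family `G R`, jointly smooth on `{R⋆ < R} × X`, of
ADMISSIBLE data equal to `d` off `e.far R` and EXACTLY isotropic Schwarzschild(`m R`), `k = 0`, beyond chart radius `32R`.
[cite: MaoOhTao2023, Thm 1.7, Rem 1.8–1.11] -/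
def Sig.stub_farGluing : Prop :=
  ∀ (X : Type) [TopologicalSpace X] [ChartedSpace E3 X] [IsManifold (𝓡 3) ∞ X] [T2Space X]
    [SecondCountableTopology X] [ConnectedSpace X], ∀ d ∈ admissibleVacuumData X,
    ∃ (η : ℝ) (e : AFEnd X) (Rstar : ℝ) (m : ℝ → ℝ) (G : ℝ → InitialDataSet (𝓡 3) X),
      0 < η ∧ e.IsSoleEnd ∧ e.R < Rstar ∧ ContDiff ℝ ∞ m ∧
      SmoothSectionsOn 𝓘(ℝ, ℝ) G {p : ℝ × X | Rstar < p.1} ∧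
      ∀ R : ℝ, Rstar < R → G R ∈ admissibleVacuumData X ∧ (∀ x ∉ e.far R, AgreeAt (G R) d x) ∧
        η * R ≤ m R ∧ IsExactSchwarzschildBeyond e (G R) (m R) (32 * R)

/-- **The universal socket bag** (open-sheet form; the hypothesis of the landed reduction
`universalWitnessFamily_of_farGluing_of_socketBag`).  For every `μ₀ > 0` there are `0 < μ ≤ μ₀`, `M > 4` and a datum `C` on `ℝ³`
which solves the vacuum constraints OUTSIDE the unit ball, is EXACTLY `((1 + μ/2‖y‖)⁴ δ, 0)` on `{1 < ‖y‖ < 2}` and EXACTLY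
`((1 + M/2‖y‖)⁴ δ, 0)` on the open exterior sheet `{‖y‖ > M/2}`. [cite: MaoOhTao2023, Thm 1.7] -/
def Sig.stub_socketBag : Prop :=
  ∀ μ₀ : ℝ, 0 < μ₀ → ∃ μ : ℝ, 0 < μ ∧ μ ≤ μ₀ ∧
    ∃ (M : ℝ) (C : InitialDataSet (𝓡 3) E3), 4 < M ∧
      VacuumOn {y : E3 | 1 < ‖y‖} C ∧ IsSchwarzschildAnnulus C μ ∧ IsIsotropicBeyond M (M / 2) C

/-- **Stub S0 — `stub_gluingFact` (NAMED-FACT DEBT, not a proving task): the PRINTED, vendored gluing theorem**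
`Literature.Geometry.Lorentzian.MaoOhTao.ObstructionFreeAnnularGluing` (Mao–Oh–Tao arXiv:2308.13031 Thm 1.7 + Rem 1.9; file
`Literature/Geometry/Lorentzian/ObstructionFreeGluing.lean`), declared as a stub only because skeleton hypotheses must be registered
obligations or declared stubs (`skeleton.extra-hypothesis`); the line is CLOSED CONDITIONALLY on exactly this printed theorem, as is
crux 10052's collar side (its `stub_gluingFact`). [cite: MaoOhTao2023, Thm 1.7, Rem 1.9] -/
def Sig.stub_gluingFact : Prop := ObstructionFreeAnnularGluing

/-- **Stub S3d — `stub_bulkAt` (XL; conjunct 4 of crux 10052 gen-1's `stub_explicit`, REPAIRED).** The centrally symmetric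
Brill–Lindquist bulk `(A + Σ_j α_j/|y − c_j|)⁴ δ` and its `N + 2` Thm-1.7 sites, all thresholds met by separation of scales.  REPAIR
(c2): gen-1's form quantifies `∀ μ' > 0` OUTSIDE `BulkAt`, which is FALSE — the central site's in-field `schwField (μ'/64)` has `C⁰`
deviation `≥ μ'/32` at `|y| = 1`, and `MOTHyp` forces `sIn₀² < μo ΔE < μo εo²`, impossible once `μ' ≥ 32 εo √μo`; the bulk can only
serve core masses below a threshold `μ'₀` it determines (the central site's out-mass).  Repaired: `∃ μ'₀ > 0, ∀ μ' ∈ (0, μ'₀]`. [folklore] -/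
def Sig.stub_bulkAt : Prop :=
  ∀ η : ℝ → ℝ, IsBump η → ∀ (εo μo M : ℝ), 0 < εo → 0 < μo → 0 < M →
    ∃ μ'₀ : ℝ, 0 < μ'₀ ∧ ∀ μ' : ℝ, 0 < μ' → μ' ≤ μ'₀ → BulkAt η εo μo M μ'

/-- **Stub S4♯ — `stub_plugDataPlusSharp_of` (S; the landed `stub_plugDataPlusFrom_of` with the socket scale exported SHARPLY,
`16384 λ < ρ₃` — true in the construction: the central gluing ball `B(0, 64 s₀)` lies inside `{‖y‖ < ρ₃/256}`).**  Needed only for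
the DEEP form of the socket bag (route item `UniversalSocketBag`, stmt-15426), where the exterior mass must exceed 80 socket radii and
the stretch wants `λ ≤ 1`. [folklore] -/
def Sig.stub_plugDataPlusSharp_of : Prop :=
  ObstructionFreeAnnularGluing →
    (∀ (M ρ₃ X₃ : ℝ), 0 < M → 0 < ρ₃ → 0 < X₃ → X₃ * ρ₃ = (M / 2) ^ 2 →
      ∀ G : InitialDataSet (𝓡 3) E3, CapEndAt M ρ₃ X₃ G) →
    (∃ F : InitialDataSet (𝓡 3) E3, FlatVacuumDatum F) →
    (∀ m : ℝ, 0 < m → ∃ S : InitialDataSet (𝓡 3) E3, SchwDatum m S) →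
    (∀ η : ℝ → ℝ, IsBump η → ∀ (εo μo μ₀ : ℝ), 0 < εo → 0 < μo → 0 < μ₀ →
      ∃ (m sOut θ : ℝ), 0 < m ∧ m ≤ μ₀ ∧ 0 < θ ∧ SchwOutSite η εo μo m sOut θ) →
    (∀ η : ℝ → ℝ, IsBump η → ∀ (εo μo M : ℝ), 0 < εo → 0 < μo → 0 < M →
      ∃ μ'₀ : ℝ, 0 < μ'₀ ∧ ∀ μ' : ℝ, 0 < μ' → μ' ≤ μ'₀ → BulkAt η εo μo M μ') →
    ∀ μ₀ : ℝ, 0 < μ₀ → ∀ M : ℝ, 0 < M →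
      ∃ (μ ρ₃ lam : ℝ) (D₀ : InitialDataSet (𝓡 3) E3),
        0 < μ ∧ μ ≤ μ₀ ∧ 0 < ρ₃ ∧ ρ₃ < M / 40 ∧ 0 < lam ∧ 16384 * lam < ρ₃ ∧
        (∀ [D₀.metric.HasLeviCivita], D₀.IsVacuumConstraintSolution) ∧
        (∀ y : E3, ρ₃ < ‖y‖ →
          (∀ v w : E3, D₀.h.inner y v w = Schwarzschild.conformalFactor M y ^ 4 * ⟪v, w⟫_ℝ) ∧ D₀.k y = 0) ∧
        (∀ y : E3, lam < ‖y‖ → ‖y‖ < 2 * lam →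
          (∀ v w : E3, D₀.h.inner y v w = (lam ^ 2)⁻¹ * (1 + lam * μ / (2 * ‖y‖)) ^ 4 * ⟪v, w⟫_ℝ) ∧
            D₀.k y = 0)

/-- **Stub B♯ — `stub_universalSocketBag_of_plugDataPlusSharp` (M; the DEEP socket bag = route item `UniversalSocketBag`
(stmt-15426) VERBATIM, from sharp PlugData⁺).**  Take `M := 160` (`ρ₃ < 4`, `λ < 4/16384`), pull back along the LANDED radial stretch
(`exists_stretchProfile`: `Φ = λ·id` on `‖z‖ ≤ √5`, `Φ = id` on `‖z‖ ≥ √15`), and read off: vacuum everywhere, canonical socket on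
`{1 < ‖z‖ < 2}`, exact Schwarzschild(`160`) beyond `R₁ := max √15 ρ₃`, with `2 < R₁` and `40 R₁ < 160`. [folklore] -/
def Sig.stub_universalSocketBag_of_plugDataPlusSharp : Prop :=
  (∀ μ₀ : ℝ, 0 < μ₀ → ∀ M : ℝ, 0 < M →
      ∃ (μ ρ₃ lam : ℝ) (D₀ : InitialDataSet (𝓡 3) E3),
        0 < μ ∧ μ ≤ μ₀ ∧ 0 < ρ₃ ∧ ρ₃ < M / 40 ∧ 0 < lam ∧ 16384 * lam < ρ₃ ∧
        (∀ [D₀.metric.HasLeviCivita], D₀.IsVacuumConstraintSolution) ∧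
        (∀ y : E3, ρ₃ < ‖y‖ →
          (∀ v w : E3, D₀.h.inner y v w = Schwarzschild.conformalFactor M y ^ 4 * ⟪v, w⟫_ℝ) ∧ D₀.k y = 0) ∧
        (∀ y : E3, lam < ‖y‖ → ‖y‖ < 2 * lam →
          (∀ v w : E3, D₀.h.inner y v w = (lam ^ 2)⁻¹ * (1 + lam * μ / (2 * ‖y‖)) ^ 4 * ⟪v, w⟫_ℝ) ∧
            D₀.k y = 0)) →
  ∀ μ₀ : ℝ, 0 < μ₀ → ∃ μ : ℝ, 0 < μ ∧ μ ≤ μ₀ ∧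
    ∃ (M R₁ : ℝ) (C : InitialDataSet (𝓡 3) E3), 2 < R₁ ∧ 40 * R₁ < M ∧
      (∀ [C.metric.HasLeviCivita], ∀ y ∈ {y : E3 | 1 < ‖y‖},
        C.hamiltonianConstraintFn y = 0 ∧ C.momentumConstraintFn y = 0) ∧
      (∀ y : E3, 1 < ‖y‖ → ‖y‖ < 2 →
        C.h.inner y = (1 + μ / (2 * ‖y‖)) ^ 4 • (innerSL ℝ : E3 →L[ℝ] E3 →L[ℝ] ℝ) ∧ C.k y = 0) ∧
      ∀ y : E3, R₁ < ‖y‖ →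
        C.h.inner y = (1 + M / (2 * ‖y‖)) ^ 4 • (innerSL ℝ : E3 →L[ℝ] E3 →L[ℝ] ℝ) ∧ C.k y = 0

/-! ## §2 The registered stub (theorem body = the `Sig` body verbatim; the only `sorry` of the file) -/

/-- **STUB S0** (named-fact debt; shared with crux 10052's `stub_gluingFact`): the printed Mao–Oh–Tao gluing theorem. -/
theorem stub_gluingFact : ObstructionFreeAnnularGluing := by
  sorry

/-- **STUB S3d** (XL; conjunct 4 of crux 10052 gen-1's `stub_explicit`, REPAIRED quantifier `∃ μ'₀ > 0, ∀ μ' ≤ μ'₀`): the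
Brill–Lindquist bulk and its sites. -/
theorem stub_bulkAt :
  ∀ η : ℝ → ℝ, IsBump η → ∀ (εo μo M : ℝ), 0 < εo → 0 < μo → 0 < M →
    ∃ μ'₀ : ℝ, 0 < μ'₀ ∧ ∀ μ' : ℝ, 0 < μ' → μ' ≤ μ'₀ → BulkAt η εo μo M μ' := by
  sorry

/-- **STUB S4♯** (S; this crux / item 15426): sharp PlugData⁺ (`16384 λ < ρ₃`) — LANDED p121563 (wave 2), wired by name. -/
theorem stub_plugDataPlusSharp_of :
  ObstructionFreeAnnularGluing →
    (∀ (M ρ₃ X₃ : ℝ), 0 < M → 0 < ρ₃ → 0 < X₃ → X₃ * ρ₃ = (M / 2) ^ 2 →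
      ∀ G : InitialDataSet (𝓡 3) E3, CapEndAt M ρ₃ X₃ G) →
    (∃ F : InitialDataSet (𝓡 3) E3, FlatVacuumDatum F) →
    (∀ m : ℝ, 0 < m → ∃ S : InitialDataSet (𝓡 3) E3, SchwDatum m S) →
    (∀ η : ℝ → ℝ, IsBump η → ∀ (εo μo μ₀ : ℝ), 0 < εo → 0 < μo → 0 < μ₀ →
      ∃ (m sOut θ : ℝ), 0 < m ∧ m ≤ μ₀ ∧ 0 < θ ∧ SchwOutSite η εo μo m sOut θ) →
    (∀ η : ℝ → ℝ, IsBump η → ∀ (εo μo M : ℝ), 0 < εo → 0 < μo → 0 < M →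
      ∃ μ'₀ : ℝ, 0 < μ'₀ ∧ ∀ μ' : ℝ, 0 < μ' → μ' ≤ μ'₀ → BulkAt η εo μo M μ') →
    ∀ μ₀ : ℝ, 0 < μ₀ → ∀ M : ℝ, 0 < M →
      ∃ (μ ρ₃ lam : ℝ) (D₀ : InitialDataSet (𝓡 3) E3),
        0 < μ ∧ μ ≤ μ₀ ∧ 0 < ρ₃ ∧ ρ₃ < M / 40 ∧ 0 < lam ∧ 16384 * lam < ρ₃ ∧
        (∀ [D₀.metric.HasLeviCivita], D₀.IsVacuumConstraintSolution) ∧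
        (∀ y : E3, ρ₃ < ‖y‖ →
          (∀ v w : E3, D₀.h.inner y v w = Schwarzschild.conformalFactor M y ^ 4 * ⟪v, w⟫_ℝ) ∧ D₀.k y = 0) ∧
        (∀ y : E3, lam < ‖y‖ → ‖y‖ < 2 * lam →
          (∀ v w : E3, D₀.h.inner y v w = (lam ^ 2)⁻¹ * (1 + lam * μ / (2 * ‖y‖)) ^ 4 * ⟪v, w⟫_ℝ) ∧
            D₀.k y = 0) :=
  Summit.FinalStateConjecture.FinalStateConjecture.Theorems.SwallowTheDatum.UniversalWitnessFamily.stub_plugDataPlusSharp_of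

/-- **STUB B♯** (M; this crux / item 15426): the DEEP universal socket bag (route item `UniversalSocketBag` verbatim) from sharp
PlugData⁺ by the landed radial stretch at `M := 160` — LANDED p121565 (wave 2), wired by name. -/
theorem stub_universalSocketBag_of_plugDataPlusSharp :
  (∀ μ₀ : ℝ, 0 < μ₀ → ∀ M : ℝ, 0 < M →
      ∃ (μ ρ₃ lam : ℝ) (D₀ : InitialDataSet (𝓡 3) E3),
        0 < μ ∧ μ ≤ μ₀ ∧ 0 < ρ₃ ∧ ρ₃ < M / 40 ∧ 0 < lam ∧ 16384 * lam < ρ₃ ∧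
        (∀ [D₀.metric.HasLeviCivita], D₀.IsVacuumConstraintSolution) ∧
        (∀ y : E3, ρ₃ < ‖y‖ →
          (∀ v w : E3, D₀.h.inner y v w = Schwarzschild.conformalFactor M y ^ 4 * ⟪v, w⟫_ℝ) ∧ D₀.k y = 0) ∧
        (∀ y : E3, lam < ‖y‖ → ‖y‖ < 2 * lam →
          (∀ v w : E3, D₀.h.inner y v w = (lam ^ 2)⁻¹ * (1 + lam * μ / (2 * ‖y‖)) ^ 4 * ⟪v, w⟫_ℝ) ∧
            D₀.k y = 0)) →
  ∀ μ₀ : ℝ, 0 < μ₀ → ∃ μ : ℝ, 0 < μ ∧ μ ≤ μ₀ ∧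
    ∃ (M R₁ : ℝ) (C : InitialDataSet (𝓡 3) E3), 2 < R₁ ∧ 40 * R₁ < M ∧
      (∀ [C.metric.HasLeviCivita], ∀ y ∈ {y : E3 | 1 < ‖y‖},
        C.hamiltonianConstraintFn y = 0 ∧ C.momentumConstraintFn y = 0) ∧
      (∀ y : E3, 1 < ‖y‖ → ‖y‖ < 2 →
        C.h.inner y = (1 + μ / (2 * ‖y‖)) ^ 4 • (innerSL ℝ : E3 →L[ℝ] E3 →L[ℝ] ℝ) ∧ C.k y = 0) ∧
      ∀ y : E3, R₁ < ‖y‖ →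
        C.h.inner y = (1 + M / (2 * ‖y‖)) ^ 4 • (innerSL ℝ : E3 →L[ℝ] E3 →L[ℝ] ℝ) ∧ C.k y = 0 :=
  Summit.FinalStateConjecture.FinalStateConjecture.Theorems.SwallowTheDatum.UniversalWitnessFamily.stub_universalSocketBag_of_plugDataPlusSharp

/-! ## §3 The compositions (all proved; no `sorry` of their own) -/

/-- **Route item ⇒ line vocabulary**: `FarAnnulusGluing` (stmt-15427) IS `Sig.stub_farGluing` — the item inlines `SmoothSectionsOn`,
`AgreeAt` and `IsExactSchwarzschildBeyond` definitionally. [folklore] -/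
theorem farGluing_of_item : FarAnnulusGluing → Sig.stub_farGluing := fun h ↦ h

/-- **The universal socket bag from the printed fact and the bulk** — everything else LANDED: Thm 1.7 BY NAME, the cap
(`stub_capEnd`), the model data (`stub_modelData`), the Schwarzschild site (`stub_schwOutSite`) and the bulk give PlugData⁺ at every
`(μ₀, M)` (`stub_plugDataPlusFrom_of`); the radial stretch gives the canonical socket bag (`stub_socketBag_of_plugDataPlusFrom`).
[cite: MaoOhTao2023, Thm 1.7] -/
theorem socketBag_of_bulkAt : Sig.stub_gluingFact → Sig.stub_bulkAt → Sig.stub_socketBag :=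
  fun hMOT hBulk ↦
    stub_socketBag_of_plugDataPlusFrom
      (stub_plugDataPlusFrom_of hMOT stub_capEnd stub_modelData.1 stub_modelData.2 stub_schwOutSite hBulk)

/-- **The DEEP universal socket bag (route item `UniversalSocketBag`, stmt-15426) from the printed fact and the bulk** — the same
landed chain through the sharp export and the deep stretch (wave-2 stubs S4♯, B♯, landed). [cite: MaoOhTao2023, Thm 1.7] -/
theorem universalSocketBag_of_bulkAt : Sig.stub_gluingFact → Sig.stub_bulkAt → UniversalSocketBag :=
  fun hMOT hBulk ↦
    stub_universalSocketBag_of_plugDataPlusSharp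
      (stub_plugDataPlusSharp_of hMOT stub_capEnd stub_modelData.1 stub_modelData.2 stub_schwOutSite hBulk)

/-- The deep bag instantiated through the registered stub. -/
example : UniversalSocketBag :=
  universalSocketBag_of_bulkAt stub_gluingFact stub_bulkAt

/-- **THE SKELETON THEOREM (v7.3) — the route items `MGHDExists` (9937), `SubdataDevelopmentsEmbed` (10053), `FarAnnulusGluing`
(15427), BY NAME, plus the two declared stubs `stub_gluingFact` (:= the printed fact `MaoOhTao.ObstructionFreeAnnularGluing`) and
`stub_bulkAt` conclude the crux BY NAME** (the ONLY declaration of the file whose conclusion is the crux decl), through the landed reduction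
`universalWitnessFamily_of_farGluing_of_socketBag` and `socketBag_of_bulkAt`. [cite: MaoOhTao2023, Thm 1.7] -/
theorem UniversalWitnessFamily_of :
    MGHDExists → SubdataDevelopmentsEmbed → FarAnnulusGluing → Sig.stub_gluingFact → Sig.stub_bulkAt →
      UniversalWitnessFamily :=
  fun hM hE hA hMOT hBulk ↦
    universalWitnessFamily_of_farGluing_of_socketBag hM hE (farGluing_of_item hA) (socketBag_of_bulkAt hMOT hBulk)

/-- The skeleton instantiated (an `example`, so `UniversalWitnessFamily_of` stays the unique crux-concluding declaration): the crux
from the registered stub, sorried through it only, with the three route items and the printed fact as hypotheses. -/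
example (hM : MGHDExists) (hE : SubdataDevelopmentsEmbed) (hA : FarAnnulusGluing) : UniversalWitnessFamily :=
  UniversalWitnessFamily_of hM hE hA stub_gluingFact stub_bulkAt

end Summit.FinalStateConjecture.FinalStateConjecture.Cruxes.UniversalWitnessFamily.ThroatSettlesToo

end
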